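import Summits.NavierStokesRegularity.FluidComputer.LerayDeadline
import Summits.NavierStokesRegularity.FluidComputer.EnstrophyComparison
import Literature.Analysis.FluidPDE.LerayEnstrophyAPriori
import HarnessLib

/-!
# Fluid computer — the TIME FACE of the level dictionary, V: THE SPEED LIMIT (L24)

HONEST FRAMING (cell `pub-fluidc`, verbatim): *low prior, high value-of-information experiment on Tao's
machine paradigm; NOT a claim that NS blows up.* Theorem side of the cell; nothing here is evidence of blow-up.
The converse face of the countdown (`LerayClock.enstrophy_clock`: the clock cannot run SLOWER than
`T − t ≥ cν³/Z(t)²`): the clock cannot run FASTER than the cubic law either. For every maximal smooth solution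
`(u, p)` of the unforced Navier–Stokes system on `ℝ³ × [0, T)` (`ν > 0`) which is Leray–Hopf from `u 0`, with
`Z(t) = ∫|∇u(t)|²`:

* `speed_window` — the local statement along one of Leray's regular windows: if `u` restarts at `σ ∈ (0, T)`
  with `‖∇u(σ)‖₂² ≤ A` and `A² d ≤ c₀ ν³` (`c₀` a constant of `LerayLocalRegularH1With`), then on `(σ, σ + d]` the
  enstrophy `Z` is continuous and obeys, for `σ < a ≤ b ≤ σ + d`, `Z(b)² (1 − 2κν⁻³ Z(a)² (b − a)) ≤ Z(a)²`
  (Leray's regular solution from `u(σ)` coincides with `u` there — weak–strong uniqueness — and lies in Tao's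
  class on every `[σ + δ, σ + d]`, where the tree's cubic enstrophy inequality `exists_enstrophy_cubic_ineq`
  (Robinson–Rodrigo–Sadowski 2016, (6.7)) and the comparison lemma `EnstrophyComparison.sq_mul_le_of_cubic` apply);
* `continuousWithinAt_enstrophy` — `Z` is right-continuous at every `a ∈ (0, T)` (a window around `a`);
* `speed_limit` (**L24, THE SPEED LIMIT**) — absolute `κ, c₀ > 0` such that for every `0 < a ≤ b < T` with
  `Z(a)² (b − a) < c₀ ν³`: `Z(b)² · (1 − 2κν⁻³ Z(a)² (b − a)) ≤ Z(a)²`, i.e. `Z(b) ≤ Z(a)/√(1 − 2κν⁻³Z(a)²(b − a))`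
  while the root is real — reaching enstrophy `Z(b)` from `Z(a)` takes at least `ν³ (Z(a)⁻² − Z(b)⁻²)/(2κ)`; in
  the machine's words the hand-off clock cannot beat the cubic law, and as `b → T` (where `Z → ∞`) this is the
  countdown again with `c = 1/(2κ)` on windows inside the local lifespan.

HONEST SIZE NOTE: `κ`, `c₀` inexplicit (Sobolev × Serrin constants). FIXED-WINDOW statement: unlike the countdown
it speaks about two finite times and is checkable in form against any enstrophy curve, but only as the word
'sub-cubic'. Necessity only. 0 sorry; no new definitions, no named facts.

## References

* J. Leray, Acta Math. 63 (1934) 193–248, §20. [Leray1934]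
* J. C. Robinson, J. L. Rodrigo, W. Sadowski, *The Three-Dimensional Navier–Stokes Equations*, CUP 2016,
  Thm. 6.8 (proof, (6.7)–(6.9)), Lemma 6.11, Thm. 8.17. [RobinsonRodrigoSadowski2016]
-/

noncomputable section

open MeasureTheory Set Function Filter Topology Metric
open scoped ENNReal NNReal RealInnerProductSpace
open Literature.Analysis.FluidPDE Literature.Analysis.FunctionSpaces
open Literature.Analysis.FluidPDE.LPBounds (gradSq)
open Summit.NavierStokesRegularity.FluidComputer.LerayClock
open Summit.NavierStokesRegularity.FluidComputer.EnstrophyComparison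

namespace Summit.NavierStokesRegularity.FluidComputer.LeraySpeedLimit

/-! ## One regular window -/

/-- **The speed limit along one of Leray's regular windows.** Let `κ > 0` satisfy the cubic enstrophy inequality
of Tao's class (the content of `exists_enstrophy_cubic_ineq`) and `c₀` be a lifespan constant of Leray's regular
local `H¹` theory. Along a maximal smooth Leray–Hopf solution `(u, p)` (`ν > 0`), let `σ ∈ (0, T)`,
`‖∇u(σ)‖₂² ≤ A`, `d > 0` with `σ + d < T` and `A² d ≤ c₀ ν³`. Then for `σ < a ≤ b ≤ σ + d`: the enstrophy
`Z(t) = ∫|∇u(t)|²` is continuous on `[a, σ + d]`, and if `Z(a) > 0` then `Z(b)² (1 − 2κν⁻³ Z(a)² (b − a)) ≤ Z(a)²`.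
[cite: RobinsonRodrigoSadowski2016, Thm. 6.8 (proof, (6.7)-(6.9)) with Thm. 8.17] -/
theorem speed_window {ν T c₀ κ : ℝ} (hν : 0 < ν) (hT : 0 < T) (hκ : 0 < κ)
    (hreg : LerayLocalRegularH1With c₀)
    (hcubic : ∀ ⦃ν' T' : ℝ⦄, 0 < ν' → 0 < T' →
      ∀ ⦃w : ℝ → EuclideanSpace ℝ (Fin 3) → EuclideanSpace ℝ (Fin 3)⦄ ⦃q : ℝ → EuclideanSpace ℝ (Fin 3) → ℝ⦄,
      IsClassicalNSSolutionOn (Icc 0 T') ν' 0 w q → HasBoundedSobolevNormsOn (Icc 0 T') w →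
      HasBoundedSobolevNormsOn (Icc 0 T') (timeDerivWithin (Icc 0 T') w) →
      (∀ n : ℕ, ∃ C : ℝ≥0, ∀ t ∈ Icc 0 T', ∫⁻ x, ‖iteratedFDeriv ℝ n (q t) x‖ₑ ^ 2 ≤ C) →
      ContinuousOn (fun t => ∫ x, frobeniusNormSq (fderiv ℝ (w t) x)) (Icc 0 T') ∧
      (∀ b ∈ Icc 0 T', ∫ x, frobeniusNormSq (fderiv ℝ (w b) x) ≤
        (∫ x, frobeniusNormSq (fderiv ℝ (w 0) x)) +
          κ * (ν' ^ 3)⁻¹ * ∫ t in (0 : ℝ)..b, (∫ x, frobeniusNormSq (fderiv ℝ (w t) x)) ^ 3) ∧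
      (∀ t ∈ Icc 0 T', ENNReal.ofReal (∫ x, frobeniusNormSq (fderiv ℝ (w t) x)) =
        ∫⁻ x, ENNReal.ofReal (frobeniusNormSq (fderiv ℝ (w t) x))))
    {u : ℝ → EuclideanSpace ℝ (Fin 3) → EuclideanSpace ℝ (Fin 3)} {p : ℝ → EuclideanSpace ℝ (Fin 3) → ℝ}
    (hmax : IsMaximalSmoothSolution ν 0 u p T) (hLH : IsLerayHopfOn T ν 0 (u 0) u)
    {σ : ℝ} (hσ : σ ∈ Ioo 0 T) {A d : ℝ} (hA : 0 ≤ A) (hAσ : eWeakGradL2Sq (u σ) ≤ ENNReal.ofReal A)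
    (hd : 0 < d) (hσd : σ + d < T) (hAd : A ^ 2 * d ≤ c₀ * ν ^ 3)
    {a b : ℝ} (hσa : σ < a) (hab : a ≤ b) (hbd : b ≤ σ + d) :
    ContinuousOn (fun t => (∫⁻ x, ENNReal.ofReal (frobeniusNormSq (fderiv ℝ (u t) x))).toReal) (Icc a (σ + d)) ∧
    (0 < (∫⁻ x, ENNReal.ofReal (frobeniusNormSq (fderiv ℝ (u a) x))).toReal →
      (∫⁻ x, ENNReal.ofReal (frobeniusNormSq (fderiv ℝ (u b) x))).toReal ^ 2 *
          (1 - 2 * (κ * (ν ^ 3)⁻¹) * (∫⁻ x, ENNReal.ofReal (frobeniusNormSq (fderiv ℝ (u a) x))).toReal ^ 2 *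
            (b - a)) ≤
        (∫⁻ x, ENNReal.ofReal (frobeniusNormSq (fderiv ℝ (u a) x))).toReal ^ 2) := by
  -- Leray's regular solution from `u σ` on `(0, d]`
  have hu2 : MemLp (u σ) 2 volume := hLH.memLp σ ⟨hσ.1.le, hσ.2.le⟩
  have hLHσ : IsLerayHopfOn d ν 0 (u σ) (fun t => u (t + σ)) := by
    have h := isLerayHopfOn_translate hν hT hmax.1 hLH hσ (T₂ := σ + d) ⟨by linarith, hσd⟩
    rwa [add_sub_cancel_left] at h
  have hdiv : IsWeaklyDivFree (u σ) := hLHσ.isWeaklyDivFree_datum hd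
  obtain ⟨v, q, hv, -, hvreg, hns, hclv⟩ := hreg hν hd hu2 hdiv hA hAσ hAd
  -- weak–strong uniqueness on `(0, d]` and pointwise agreement on `(σ, σ + d]`
  have hS : MemLqLp ∞ 6 v (Ioo 0 d) := memLqLp_top_six_of_isH1RegularOn_Icc hvreg fun t ht => hv.memLp t ht
  have hae : ∀ t ∈ Ioc 0 d, u (t + σ) =ᵐ[volume] v t := fun t ht =>
    serrin_weak_strong_uniqueness_holds hν hd hv hu2 (q := ∞) (r := 6) (by norm_num)
      serrin_exponents_top_six hS hLHσ t ht
  have heq : ∀ τ ∈ Ioc σ (σ + d), u τ = v (τ - σ) := by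
    intro τ hτ
    have h1 : u τ =ᵐ[volume] v (τ - σ) := by
      have h := hae (τ - σ) ⟨sub_pos.2 hτ.1, by linarith [hτ.2]⟩
      rwa [sub_add_cancel] at h
    have hcu : Continuous (u τ) :=
      (hmax.1.contDiff_velocity ⟨hσ.1.le.trans hτ.1.le, hτ.2.trans_lt hσd⟩).continuous
    have hcv : Continuous (v (τ - σ)) := (hns.contDiff_velocity ⟨sub_pos.2 hτ.1, by linarith [hτ.2]⟩).continuous
    exact (Continuous.ae_eq_iff_eq volume hcu hcv).1 h1
  -- the degenerate window `a = σ + d`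
  rcases eq_or_lt_of_le (hab.trans hbd) with hda | hda
  · have hba : b = a := le_antisymm (hda ▸ hbd) hab
    subst hba
    refine ⟨?_, fun _ => ?_⟩
    · rw [hda, Icc_self]
      exact continuousOn_singleton _ _
    · simp
  -- the slab `[a, σ + d]` shifted to `[0, Td]`, `Td = σ + d - a`, `δ = a - σ`
  set δ : ℝ := a - σ with hδ
  set Td : ℝ := σ + d - a with hTd
  have hδ0 : 0 < δ := sub_pos.2 hσa
  have hδd : δ ≤ d := by rw [hδ]; linarith
  have hTd0 : 0 < Td := by rw [hTd]; linarith
  obtain ⟨hSob, hSobdt, -, hp⟩ := hclv δ hδ0 hδd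
  set W : ℝ → EuclideanSpace ℝ (Fin 3) → EuclideanSpace ℝ (Fin 3) := fun t => v (t + δ) with hW
  set P : ℝ → EuclideanSpace ℝ (Fin 3) → ℝ := fun t => q (t + δ) with hP
  have hpre : Icc 0 Td ⊆ (· + δ) ⁻¹' Ioc 0 d := fun t ht =>
    ⟨by simp only [hδ]; linarith [ht.1], by simp only [hTd] at ht; simp only [hδ]; linarith [ht.2]⟩
  have hpre' : ∀ t ∈ Icc 0 Td, t + δ ∈ Icc δ d := fun t ht =>
    ⟨by linarith [ht.1], by simp only [hTd] at ht; simp only [hδ]; linarith [ht.2]⟩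
  have hsolw : IsClassicalNSSolutionOn (Icc 0 Td) ν 0 W P :=
    (hns.comp_add_right δ).mono hpre (uniqueDiffOn_Icc hTd0)
  have hWB : HasBoundedSobolevNormsOn (Icc 0 Td) W := fun n =>
    (hSob n).imp fun C hC t ht => hC (t + δ) (hpre' t ht)
  have htd : ∀ t ∈ Icc 0 Td, timeDerivWithin (Icc 0 Td) W t = timeDerivWithin (Ioc 0 d) v (t + δ) := by
    intro t ht
    funext x
    rw [(hns.comp_add_right δ).smooth_velocity.timeDerivWithin_eq_of_subset hpre (uniqueDiffOn_Icc hTd0) ht x]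
    exact timeDerivWithin_comp_add_right _ v δ t x
  have hWB' : HasBoundedSobolevNormsOn (Icc 0 Td) (timeDerivWithin (Icc 0 Td) W) := fun n =>
    (hSobdt n).imp fun C hC t ht => by rw [htd t ht]; exact hC (t + δ) (hpre' t ht)
  have hPB : ∀ n : ℕ, ∃ C : ℝ≥0, ∀ t ∈ Icc 0 Td, ∫⁻ x, ‖iteratedFDeriv ℝ n (P t) x‖ₑ ^ 2 ≤ C := fun n =>
    (hp n).imp fun C hC t ht => hC (t + δ) (hpre' t ht)
  obtain ⟨hGc, hGineq, hGeq⟩ := hcubic hν hTd0 hsolw hWB hWB' hPB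
  -- the real enstrophy `G` of the window and its identification with `Z ∘ u`
  set G : ℝ → ℝ := fun t => ∫ x, frobeniusNormSq (fderiv ℝ (W t) x) with hG
  have hG0 : ∀ t, 0 ≤ G t := fun t => integral_nonneg fun x => frobeniusNormSq_nonneg _
  have hWu : ∀ t ∈ Icc 0 Td, W t = u (t + a) := by
    intro t ht
    have hta : t + a ∈ Ioc σ (σ + d) := ⟨by linarith [ht.1], by simp only [hTd] at ht; linarith [ht.2]⟩
    rw [heq (t + a) hta]
    simp only [hW, hδ]
    congr 1
    ring
  have hZG : ∀ t ∈ Icc 0 Td,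
      (∫⁻ x, ENNReal.ofReal (frobeniusNormSq (fderiv ℝ (u (t + a)) x))).toReal = G t := by
    intro t ht
    rw [← hWu t ht, ← hGeq t ht, ENNReal.toReal_ofReal (hG0 t)]
  refine ⟨?_, fun hZa => ?_⟩
  · -- continuity on `[a, σ + d]`
    have hmaps : MapsTo (fun s => s - a) (Icc a (σ + d)) (Icc 0 Td) := fun s hs =>
      ⟨by linarith [hs.1], by simp only [hTd]; linarith [hs.2]⟩
    have hc : ContinuousOn (fun s => G (s - a)) (Icc a (σ + d)) :=
      hGc.comp (continuousOn_id.sub continuousOn_const) hmaps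
    refine hc.congr fun s hs => ?_
    have h := hZG (s - a) (hmaps hs)
    simp only [sub_add_cancel] at h
    exact h
  · -- the comparison lemma on `[0, Td]` at `b - a`
    have hba : b - a ∈ Icc 0 Td := ⟨sub_nonneg.2 hab, by simp only [hTd]; linarith⟩
    have hZa' : (∫⁻ x, ENNReal.ofReal (frobeniusNormSq (fderiv ℝ (u a) x))).toReal = G 0 := by
      have h := hZG 0 ⟨le_rfl, hTd0.le⟩
      rwa [zero_add] at h
    have hZb' : (∫⁻ x, ENNReal.ofReal (frobeniusNormSq (fderiv ℝ (u b) x))).toReal = G (b - a) := by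
      have h := hZG (b - a) hba
      rwa [sub_add_cancel] at h
    have hpos : 0 < G 0 := hZa' ▸ hZa
    have hL : 0 ≤ κ * (ν ^ 3)⁻¹ := by positivity
    have key := sq_mul_le_of_cubic hL hTd0 hGc (fun t _ => hG0 t) hpos hGineq (b - a) hba
    rw [hZa', hZb']
    exact key

/-! ## Right-continuity of the enstrophy -/

/-- **The enstrophy is right-continuous at every interior time.** Along a maximal smooth Leray–Hopf solution
(`ν > 0`), for every `a ∈ (0, T)` the real enstrophy `t ↦ ∫|∇u(t)|²` is continuous within `(a, ∞)` at `a`: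
a regular window from a restart time `σ₀ < a` (lifespan uniform on `[a/2, a]` by the `H¹` bound there,
`IsMaximalSmoothSolution.isH1RegularOn_Ioo`) covers `a`. [cite: RobinsonRodrigoSadowski2016, Thm. 6.8 (proof, (6.7)-(6.9)) with Thm. 8.17] -/
theorem continuousWithinAt_enstrophy {ν T c₀ κ : ℝ} (hν : 0 < ν) (hT : 0 < T) (hκ : 0 < κ) (hc₀ : 0 < c₀)
    (hreg : LerayLocalRegularH1With c₀)
    (hcubic : ∀ ⦃ν' T' : ℝ⦄, 0 < ν' → 0 < T' →
      ∀ ⦃w : ℝ → EuclideanSpace ℝ (Fin 3) → EuclideanSpace ℝ (Fin 3)⦄ ⦃q : ℝ → EuclideanSpace ℝ (Fin 3) → ℝ⦄,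
      IsClassicalNSSolutionOn (Icc 0 T') ν' 0 w q → HasBoundedSobolevNormsOn (Icc 0 T') w →
      HasBoundedSobolevNormsOn (Icc 0 T') (timeDerivWithin (Icc 0 T') w) →
      (∀ n : ℕ, ∃ C : ℝ≥0, ∀ t ∈ Icc 0 T', ∫⁻ x, ‖iteratedFDeriv ℝ n (q t) x‖ₑ ^ 2 ≤ C) →
      ContinuousOn (fun t => ∫ x, frobeniusNormSq (fderiv ℝ (w t) x)) (Icc 0 T') ∧
      (∀ b ∈ Icc 0 T', ∫ x, frobeniusNormSq (fderiv ℝ (w b) x) ≤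
        (∫ x, frobeniusNormSq (fderiv ℝ (w 0) x)) +
          κ * (ν' ^ 3)⁻¹ * ∫ t in (0 : ℝ)..b, (∫ x, frobeniusNormSq (fderiv ℝ (w t) x)) ^ 3) ∧
      (∀ t ∈ Icc 0 T', ENNReal.ofReal (∫ x, frobeniusNormSq (fderiv ℝ (w t) x)) =
        ∫⁻ x, ENNReal.ofReal (frobeniusNormSq (fderiv ℝ (w t) x))))
    {u : ℝ → EuclideanSpace ℝ (Fin 3) → EuclideanSpace ℝ (Fin 3)} {p : ℝ → EuclideanSpace ℝ (Fin 3) → ℝ}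
    (hmax : IsMaximalSmoothSolution ν 0 u p T) (hLH : IsLerayHopfOn T ν 0 (u 0) u)
    {a : ℝ} (ha : a ∈ Ioo 0 T) :
    ContinuousWithinAt (fun t => (∫⁻ x, ENNReal.ofReal (frobeniusNormSq (fderiv ℝ (u t) x))).toReal)
      (Ioi a) a := by
  -- a uniform `H¹` bound on `[a/2, a]`
  have hH1 : IsH1RegularOn (Ioo 0 T) u := hmax.isH1RegularOn_Ioo hν hT hLH
  obtain ⟨M, hMtop, hM⟩ := hH1.exists_forall_le (isCompact_Icc : IsCompact (Icc (a / 2) a))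
    fun t ht => ⟨by linarith [ht.1, ha.1], ht.2.trans_lt ha.2⟩
  set Mr : ℝ := M.toReal with hMr
  have hMr0 : 0 ≤ Mr := ENNReal.toReal_nonneg
  -- the lifespan and the restart time
  set d₀ : ℝ := min (min (c₀ * ν ^ 3 / (Mr ^ 2 + 1)) ((T - a) / 2)) a with hd₀
  have hcν : 0 < c₀ * ν ^ 3 := by positivity
  have hd₀pos : 0 < d₀ := lt_min (lt_min (div_pos hcν (by positivity)) (by linarith [ha.2])) ha.1
  have hd₀a : d₀ ≤ a := min_le_right _ _
  have hd₀T : d₀ ≤ (T - a) / 2 := (min_le_left _ _).trans (min_le_right _ _)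
  have hd₀c : d₀ ≤ c₀ * ν ^ 3 / (Mr ^ 2 + 1) := (min_le_left _ _).trans (min_le_left _ _)
  set σ₀ : ℝ := a - d₀ / 2 with hσ₀
  have hσ₀I : σ₀ ∈ Ioo 0 T := ⟨by rw [hσ₀]; linarith, by rw [hσ₀]; linarith [ha.2]⟩
  have hσ₀a : σ₀ ∈ Icc (a / 2) a := ⟨by rw [hσ₀]; linarith, by rw [hσ₀]; linarith⟩
  have hAσ : eWeakGradL2Sq (u σ₀) ≤ ENNReal.ofReal Mr :=
    calc eWeakGradL2Sq (u σ₀) ≤ eH1NormSq (u σ₀) := le_add_self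
      _ ≤ M := hM σ₀ hσ₀a
      _ = ENNReal.ofReal Mr := (ENNReal.ofReal_toReal hMtop.ne).symm
  have hσd : σ₀ + d₀ < T := by rw [hσ₀]; linarith
  have hAd : Mr ^ 2 * d₀ ≤ c₀ * ν ^ 3 := by
    calc Mr ^ 2 * d₀ ≤ Mr ^ 2 * (c₀ * ν ^ 3 / (Mr ^ 2 + 1)) := mul_le_mul_of_nonneg_left hd₀c (sq_nonneg _)
      _ = c₀ * ν ^ 3 * (Mr ^ 2 / (Mr ^ 2 + 1)) := by ring
      _ ≤ c₀ * ν ^ 3 * 1 :=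
          mul_le_mul_of_nonneg_left (div_le_one_of_le₀ (by linarith) (by positivity)) hcν.le
      _ = c₀ * ν ^ 3 := mul_one _
  -- the window `(σ₀, σ₀ + d₀] ∋ a` in its interior
  have hwin := (speed_window hν hT hκ hreg hcubic hmax hLH hσ₀I hMr0 hAσ hd₀pos hσd hAd
    (a := a) (b := a) (by rw [hσ₀]; linarith) le_rfl (by rw [hσ₀]; linarith)).1
  have hae : a < σ₀ + d₀ := by rw [hσ₀]; linarith
  have hcw : ContinuousWithinAt
      (fun t => (∫⁻ x, ENNReal.ofReal (frobeniusNormSq (fderiv ℝ (u t) x))).toReal) (Icc a (σ₀ + d₀)) a :=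
    hwin a ⟨le_rfl, hae.le⟩
  exact (hcw.mono Ioo_subset_Icc_self).mono_of_mem_nhdsWithin (Ioo_mem_nhdsGT hae)

/-! ## L24: the speed limit -/

/-- **L24 — THE SPEED LIMIT: the enstrophy cannot outrun the cubic law.** There are absolute `κ > 0`,
`c₀ > 0` such that for every `ν > 0`, `T > 0` and every maximal smooth solution `(u, p)` of the unforced
Navier–Stokes system on `ℝ³ × [0, T)` which is Leray–Hopf from `u 0`, with `Z(t) = ∫|∇u(t)|²` (finite and positive
on `(0, T)`): for all `0 < a ≤ b < T` with `Z(a)² (b − a) < c₀ ν³` (the window inside Leray's local lifespan from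
`u(a)`), `Z(b)² · (1 − 2κν⁻³ Z(a)² (b − a)) ≤ Z(a)²` — i.e. `Z(b) ≤ Z(a)/√(1 − 2κν⁻³Z(a)²(b − a))` while the root
is real: reaching level `Z(b)` from `Z(a)` takes AT LEAST `ν³ (Z(a)⁻² − Z(b)⁻²)/(2κ)`. (Restart AT `a`
(`LerayClock.isLerayHopfOn_translate`), `speed_window` from `a + ε`, and `ε → 0⁺` by
`continuousWithinAt_enstrophy`.) [cite: RobinsonRodrigoSadowski2016, Thm. 6.8 (proof, (6.7)-(6.9)) and Lemma 6.11]
[cite: Leray1934, §20] -/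
theorem speed_limit :
    ∃ κ c₀ : ℝ, 0 < κ ∧ 0 < c₀ ∧ ∀ (ν T : ℝ), 0 < ν → 0 < T →
      ∀ (u : ℝ → EuclideanSpace ℝ (Fin 3) → EuclideanSpace ℝ (Fin 3)) (p : ℝ → EuclideanSpace ℝ (Fin 3) → ℝ),
      IsMaximalSmoothSolution ν 0 u p T → IsLerayHopfOn T ν 0 (u 0) u →
      ∀ a ∈ Ioo 0 T, ∀ b ∈ Ico a T,
        (∫⁻ x, ENNReal.ofReal (frobeniusNormSq (fderiv ℝ (u a) x))).toReal ^ 2 * (b - a) < c₀ * ν ^ 3 →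
        (∫⁻ x, ENNReal.ofReal (frobeniusNormSq (fderiv ℝ (u b) x))).toReal ^ 2 *
            (1 - 2 * κ * (ν ^ 3)⁻¹ * (∫⁻ x, ENNReal.ofReal (frobeniusNormSq (fderiv ℝ (u a) x))).toReal ^ 2 *
              (b - a)) ≤
          (∫⁻ x, ENNReal.ofReal (frobeniusNormSq (fderiv ℝ (u a) x))).toReal ^ 2 := by
  obtain ⟨κ, hκ, hcubic0⟩ := exists_enstrophy_cubic_ineq
  obtain ⟨c₀, hc₀, hreg⟩ := leray_local_regular_H1_holds
  obtain ⟨cW, hcW, HW⟩ := LerayDeadline.leray_window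
  have hcubic : ∀ ⦃ν' T' : ℝ⦄, 0 < ν' → 0 < T' →
      ∀ ⦃w : ℝ → EuclideanSpace ℝ (Fin 3) → EuclideanSpace ℝ (Fin 3)⦄ ⦃q : ℝ → EuclideanSpace ℝ (Fin 3) → ℝ⦄,
      IsClassicalNSSolutionOn (Icc 0 T') ν' 0 w q → HasBoundedSobolevNormsOn (Icc 0 T') w →
      HasBoundedSobolevNormsOn (Icc 0 T') (timeDerivWithin (Icc 0 T') w) →
      (∀ n : ℕ, ∃ C : ℝ≥0, ∀ t ∈ Icc 0 T', ∫⁻ x, ‖iteratedFDeriv ℝ n (q t) x‖ₑ ^ 2 ≤ C) →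
      ContinuousOn (fun t => ∫ x, frobeniusNormSq (fderiv ℝ (w t) x)) (Icc 0 T') ∧
      (∀ b ∈ Icc 0 T', ∫ x, frobeniusNormSq (fderiv ℝ (w b) x) ≤
        (∫ x, frobeniusNormSq (fderiv ℝ (w 0) x)) +
          κ * (ν' ^ 3)⁻¹ * ∫ t in (0 : ℝ)..b, (∫ x, frobeniusNormSq (fderiv ℝ (w t) x)) ^ 3) ∧
      (∀ t ∈ Icc 0 T', ENNReal.ofReal (∫ x, frobeniusNormSq (fderiv ℝ (w t) x)) =
        ∫⁻ x, ENNReal.ofReal (frobeniusNormSq (fderiv ℝ (w t) x))) := by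
    intro ν' T' hν' hT' w q h1 h2 h3 h4
    obtain ⟨hc, hi, -, he⟩ := hcubic0 hν' hT' h1 h2 h3 h4
    exact ⟨hc, hi, he⟩
  refine ⟨κ, c₀, hκ, hc₀, fun ν T hν hT u p hmax hLH a ha b hb hsmall => ?_⟩
  set Z : ℝ → ℝ := fun t => (∫⁻ x, ENNReal.ofReal (frobeniusNormSq (fderiv ℝ (u t) x))).toReal with hZ
  -- `Z(a) > 0`
  have hZa : 0 < Z a := (HW ν T hν hT u p hmax hLH a ha).1
  -- the trivial case `a = b`
  rcases hb.1.eq_or_lt with hab | hab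
  · subst hab
    show Z a ^ 2 * (1 - 2 * κ * (ν ^ 3)⁻¹ * Z a ^ 2 * (a - a)) ≤ Z a ^ 2
    simp
  -- restart AT `a`: the window `(a, a + d]` with `d > b - a`, `a + d < T`, `Z(a)² d ≤ c₀ ν³`
  have hcν : 0 < c₀ * ν ^ 3 := by positivity
  set d : ℝ := min ((b - a) / 2 + c₀ * ν ^ 3 / (2 * Z a ^ 2)) ((b - a + (T - a)) / 2) with hd
  have hZa2 : 0 < Z a ^ 2 := by positivity
  have hdba : b - a < d := by
    refine lt_min ?_ (by linarith [hb.2])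
    have h1 : b - a < c₀ * ν ^ 3 / Z a ^ 2 := by rw [lt_div_iff₀ hZa2]; linarith [hsmall]
    have h2 : c₀ * ν ^ 3 / (2 * Z a ^ 2) = (c₀ * ν ^ 3 / Z a ^ 2) / 2 := by ring
    rw [h2]
    linarith
  have hdpos : 0 < d := lt_of_le_of_lt (sub_nonneg.2 hb.1) hdba
  have hdT : a + d < T := by
    have : d ≤ (b - a + (T - a)) / 2 := min_le_right _ _
    linarith [hb.2]
  have hZd : Z a ^ 2 * d ≤ c₀ * ν ^ 3 := by
    have h1 : d ≤ (b - a) / 2 + c₀ * ν ^ 3 / (2 * Z a ^ 2) := min_le_left _ _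
    calc Z a ^ 2 * d ≤ Z a ^ 2 * ((b - a) / 2 + c₀ * ν ^ 3 / (2 * Z a ^ 2)) :=
          mul_le_mul_of_nonneg_left h1 hZa2.le
      _ = Z a ^ 2 * (b - a) / 2 + c₀ * ν ^ 3 / 2 := by field_simp
      _ ≤ c₀ * ν ^ 3 := by linarith [hsmall]
  -- the classical gradient bounds the weak dissipation at `a`
  obtain ⟨hZga, hZtop⟩ := lintegral_frobeniusNormSq_eq_gradSq hν hT hmax hLH ha
  have hAa : eWeakGradL2Sq (u a) ≤ ENNReal.ofReal (Z a) := by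
    have hC1 : ContDiff ℝ 1 (u a) := (hmax.1.contDiff_velocity ⟨ha.1.le, ha.2⟩).of_le (by exact_mod_cast le_top)
    refine (eWeakGradL2Sq_le_of_hasWeakGradient (hasWeakGradient_fderiv_of_contDiff hC1)).trans_eq ?_
    rw [hZ]
    simp only
    rw [hZga, ENNReal.ofReal_toReal hZtop]
  -- the window inequality from every `a' ∈ (a, b]`
  have hstep : ∀ a' ∈ Ioo a b, Z b ^ 2 * (1 - 2 * (κ * (ν ^ 3)⁻¹) * Z a' ^ 2 * (b - a')) - Z a' ^ 2 ≤ 0 := by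
    intro a' ha'
    have hZa' : 0 < Z a' := (HW ν T hν hT u p hmax hLH a' ⟨ha.1.trans ha'.1, ha'.2.trans hb.2⟩).1
    have h := (speed_window hν hT hκ hreg hcubic hmax hLH ha hZa.le hAa hdpos hdT hZd
      ha'.1 ha'.2.le (by linarith [hdba])).2 hZa'
    linarith [h]
  -- pass to the limit `a' → a⁺`
  have hcont := continuousWithinAt_enstrophy hν hT hκ hc₀ hreg hcubic hmax hLH ha
  have hZt : Tendsto Z (𝓝[>] a) (𝓝 (Z a)) := hcont.tendsto
  have hid : Tendsto (fun a' : ℝ => a') (𝓝[>] a) (𝓝 a) := tendsto_nhdsWithin_of_tendsto_nhds tendsto_id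
  have hF : Tendsto (fun a' => Z b ^ 2 * (1 - 2 * (κ * (ν ^ 3)⁻¹) * Z a' ^ 2 * (b - a')) - Z a' ^ 2) (𝓝[>] a)
      (𝓝 (Z b ^ 2 * (1 - 2 * (κ * (ν ^ 3)⁻¹) * Z a ^ 2 * (b - a)) - Z a ^ 2)) :=
    ((((((hZt.pow 2).const_mul (2 * (κ * (ν ^ 3)⁻¹))).mul (tendsto_const_nhds.sub hid)).const_sub 1).const_mul
      (Z b ^ 2)).sub (hZt.pow 2))
  have hlim : Z b ^ 2 * (1 - 2 * (κ * (ν ^ 3)⁻¹) * Z a ^ 2 * (b - a)) - Z a ^ 2 ≤ 0 := by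
    refine le_of_tendsto hF ?_
    filter_upwards [Ioo_mem_nhdsGT hab] with a' ha' using hstep a' ha'
  have e : 2 * κ * (ν ^ 3)⁻¹ = 2 * (κ * (ν ^ 3)⁻¹) := by ring
  show Z b ^ 2 * (1 - 2 * κ * (ν ^ 3)⁻¹ * Z a ^ 2 * (b - a)) ≤ Z a ^ 2
  rw [e]
  linarith [hlim]

end Summit.NavierStokesRegularity.FluidComputer.LeraySpeedLimit

end
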